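import Mathlib.ModelTheory.Definability
import Mathlib.LinearAlgebra.Matrix.Determinant.Basic
import Literature.ModelTheory.ExponentialFields.RealClosedFieldTheoryProofs
import Literature.ModelTheory.ExponentialFields.DefinabilityParams
import HarnessLib

/-!
# KontsevichZagierPeriods / DefinableMoves — `CovTransfer`, bookkeeping III: a kit for
# `ℚ`-definable conditions on tuples of reals

Helper file for item stmt-KontsevichZagierPeriods-4093 (`CovTransfer`) of route
`DefinableMoves`. First-order bookkeeping in the ordered field `ℝ` with rational parameters
(`(range ℚ).Definable Language.orderedRing`, which on `ℝⁿ` is `IsSemialgebraic ℚ` by the tree's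
`definable_iff_isSemialgebraic_real_holds`): quantifier blocks over tuples, finite conjunctions
and disjunctions, polynomial atoms `p(v) = q(v)`, `p(v) < q(v)`, `p(v) ≤ q(v)` with
`p, q ∈ ℚ[X]`, and membership of a sub-tuple in a fixed `ℚ`-semialgebraic set. All folklore
(van den Dries 1998, Ch. 1 §2, §5); the shapes are those in which the side conditions of the
change-of-variables move are transcribed.
-/

noncomputable section

open Set FirstOrder FirstOrder.Language MvPolynomial

namespace Summit.KontsevichZagierPeriods.DefinableMoves.CovTransferAux

open Literature.ModelTheory.ExponentialFields

/-- `DefQ s`: `s` is definable in the ordered field `ℝ` with rational parameters. -/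
local notation:max "DefQ " s:max =>
  Set.Definable (Set.range ((↑) : ℚ → ℝ)) Literature.ModelTheory.ExponentialFields.Language.orderedRing s

variable {α : Type}

/-! ### Semialgebraic sets are definable (any index type) -/

/-- A `ℚ`-semialgebraic subset of `ℝ^ι` (any index type `ι`) is definable over `ℚ` in the ordered
field `ℝ` (the generators by atomic formulas; tree `definable_of_isSemialgebraic` is the case
`ι = Fin n`). [cite: BasuPollackRoy2006, §2.5.1 (proof of Thm. 2.77)] -/
theorem definable_of_isSemialgebraic' {ι : Type*} {s : Set (ι → ℝ)} (hs : IsSemialgebraic ℚ s) :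
    DefQ s := by
  induction hs using BooleanSubalgebra.closure_bot_sup_induction with
  | mem t ht =>
    rcases ht with ⟨p, rfl⟩ | ⟨p, rfl⟩
    · exact definable_setOf_aeval_eq_zero p
    · exact definable_setOf_aeval_pos p
  | bot => exact definable_empty
  | sup _ _ _ _ ht hu => exact ht.union hu
  | compl _ _ ht => exact ht.compl

/-! ### Quantifiers -/

/-- `∃`-block over a tuple `y : β → ℝ`. [folklore] -/
theorem definable_exists_block {β : Type} [Finite β] {P : (α → ℝ) → (β → ℝ) → Prop}
    (h : DefQ
      {g : α ⊕ β → ℝ | P (fun i => g (Sum.inl i)) (fun j => g (Sum.inr j))}) :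
    DefQ {u : α → ℝ | ∃ y : β → ℝ, P u y} := by
  have h' := h.exists_of_finite
  convert h' using 1
  ext u
  simp

/-- `∀`-block over a tuple `y : β → ℝ`. [folklore] -/
theorem definable_forall_block {β : Type} [Finite β] {P : (α → ℝ) → (β → ℝ) → Prop}
    (h : DefQ
      {g : α ⊕ β → ℝ | P (fun i => g (Sum.inl i)) (fun j => g (Sum.inr j))}) :
    DefQ {u : α → ℝ | ∀ y : β → ℝ, P u y} := by
  have h' := h.forall_of_finite
  convert h' using 1
  ext u
  simp

/-- `∃` over one real variable. [folklore] -/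
theorem definable_exists₁ {P : (α → ℝ) → ℝ → Prop}
    (h : DefQ {w : α ⊕ Unit → ℝ | P (fun i => w (Sum.inl i)) (w (Sum.inr ()))}) :
    DefQ {v : α → ℝ | ∃ y : ℝ, P v y} :=
  definable_setOf_exists_params h

/-- `∀` over one real variable. [folklore] -/
theorem definable_forall₁ {P : (α → ℝ) → ℝ → Prop}
    (h : DefQ {w : α ⊕ Unit → ℝ | P (fun i => w (Sum.inl i)) (w (Sum.inr ()))}) :
    DefQ {v : α → ℝ | ∀ y : ℝ, P v y} :=
  definable_setOf_forall_params h

/-- Finite conjunction. [folklore] -/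
theorem definable_finForall {ι : Type} [Finite ι] {P : (α → ℝ) → ι → Prop}
    (h : ∀ i, DefQ {v | P v i}) : DefQ {v : α → ℝ | ∀ i, P v i} := by
  rw [setOf_forall]
  exact definable_iInter_of_finite h

/-- Finite disjunction. [folklore] -/
theorem definable_finExists {ι : Type} [Finite ι] {P : (α → ℝ) → ι → Prop}
    (h : ∀ i, DefQ {v | P v i}) : DefQ {v : α → ℝ | ∃ i, P v i} := by
  rw [setOf_exists]
  exact definable_iUnion_of_finite h

/-! ### Atoms -/

/-- Polynomial equation atom. [folklore] -/
theorem definable_polyEq (p r : MvPolynomial α ℚ) {P : (α → ℝ) → Prop}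
    (h : ∀ v, P v ↔ aeval v p = aeval v r) : DefQ {v : α → ℝ | P v} := by
  have h1 := definable_setOf_aeval_eq_zero (ι := α) (p - r)
  convert h1 using 1
  ext v
  rw [mem_setOf_eq, mem_setOf_eq, h v, map_sub, sub_eq_zero]

/-- Strict polynomial inequality atom. [folklore] -/
theorem definable_polyLt (p r : MvPolynomial α ℚ) {P : (α → ℝ) → Prop}
    (h : ∀ v, P v ↔ aeval v p < aeval v r) : DefQ {v : α → ℝ | P v} := by
  have h1 := definable_setOf_aeval_pos (ι := α) (r - p)
  convert h1 using 1
  ext v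
  rw [mem_setOf_eq, mem_setOf_eq, h v, map_sub, sub_pos]

/-- Non-strict polynomial inequality atom. [folklore] -/
theorem definable_polyLe (p r : MvPolynomial α ℚ) {P : (α → ℝ) → Prop}
    (h : ∀ v, P v ↔ aeval v p ≤ aeval v r) : DefQ {v : α → ℝ | P v} := by
  have h1 := (definable_setOf_aeval_pos (ι := α) (p - r)).compl
  convert h1 using 1
  ext v
  simp only [mem_setOf_eq, mem_compl_iff, h v, map_sub, sub_pos, not_lt]

/-- Membership of a re-indexed sub-tuple in a definable set. [folklore] -/
theorem definable_memTuple {β : Type} {S : Set (β → ℝ)} (hS : DefQ S) (τ : β → α) :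
    DefQ {g : α → ℝ | (fun k => g (τ k)) ∈ S} :=
  hS.preimage_comp τ

/-- Membership of `(x, a)` (`x` a sub-tuple, `a` a coordinate, glued by `Fin.snoc`) in a definable
subset of `ℝ^(n+1)`. [folklore] -/
theorem definable_memSnoc {n : ℕ} {S : Set (Fin (n + 1) → ℝ)} (hS : DefQ S)
    (τ : Fin n → α) (κ : α) :
    DefQ {g : α → ℝ | (Fin.snoc (fun i => g (τ i)) (g κ) : Fin (n + 1) → ℝ) ∈ S} := by
  have h := hS.preimage_comp (Fin.snoc τ κ : Fin (n + 1) → α)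
  convert h using 1
  ext g
  simp only [mem_setOf_eq, mem_preimage]
  rw [Fin.comp_snoc]
  exact Iff.rfl

/-- Membership of `((x, y), d)` (three sub-tuples glued by `Sum.elim`) in a definable subset of
`ℝ^((n ⊕ n) ⊕ q)`. [folklore] -/
theorem definable_memSum {n q : ℕ} {W : Set ((Fin n ⊕ Fin n) ⊕ Fin q → ℝ)}
    (hW : DefQ W) (τx τy : Fin n → α) (τd : Fin q → α) :
    DefQ {g : α → ℝ |
      Sum.elim (Sum.elim (fun i => g (τx i)) (fun j => g (τy j))) (fun l => g (τd l)) ∈ W} := by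
  have h := hW.preimage_comp (Sum.elim (Sum.elim τx τy) τd)
  convert h using 1
  ext g
  simp only [mem_setOf_eq, mem_preimage]
  have : Sum.elim (Sum.elim (fun i => g (τx i)) (fun j => g (τy j))) (fun l => g (τd l)) =
      g ∘ Sum.elim (Sum.elim τx τy) τd := by
    funext k
    rcases k with ((i | j) | l) <;> rfl
  rw [this]

/-- Positivity of a coordinate. [folklore] -/
theorem definable_pos (κ : α) : DefQ {g : α → ℝ | 0 < g κ} :=
  definable_polyLt 0 (X κ) fun v => by simp

/-- Coordinatewise equality of two sub-tuples. [folklore] -/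
theorem definable_eqTuple {n : ℕ} (τ τ' : Fin n → α) :
    DefQ {g : α → ℝ | ∀ i, g (τ i) = g (τ' i)} :=
  definable_finForall fun i => definable_polyEq (X (τ i)) (X (τ' i)) fun v => by simp

/-- The sup-metric box atom `∀ i, x₁ i - x i < δ ∧ x i - x₁ i < δ`. [folklore] -/
theorem definable_box {n : ℕ} (τ₁ τ : Fin n → α) (κ : α) :
    DefQ {g : α → ℝ | ∀ i, g (τ₁ i) - g (τ i) < g κ ∧ g (τ i) - g (τ₁ i) < g κ} :=
  definable_finForall fun i => definable_setOf_and_params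
    (definable_polyLt (X (τ₁ i) - X (τ i)) (X κ) fun v => by simp)
    (definable_polyLt (X (τ i) - X (τ₁ i)) (X κ) fun v => by simp)

/-- The little-`o` atom of the derivative condition:
`∀ i, ∃ j, (y₁ i - y i - ∑ k, L i k (x₁ k - x k))² ≤ c² (x₁ j - x j)²`. [folklore] -/
theorem definable_derivAtom {n : ℕ} (τy₁ τy τx₁ τx : Fin n → α) (τL : Fin n → Fin n → α)
    (κc : α) :
    DefQ {g : α → ℝ | ∀ i, ∃ j,
      (g (τy₁ i) - g (τy i) - ∑ k, g (τL i k) * (g (τx₁ k) - g (τx k))) ^ 2 ≤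
        g κc ^ 2 * (g (τx₁ j) - g (τx j)) ^ 2} :=
  definable_finForall fun i => definable_finExists fun j =>
    definable_polyLe ((X (τy₁ i) - X (τy i) - ∑ k, X (τL i k) * (X (τx₁ k) - X (τx k))) ^ 2)
      (X κc ^ 2 * (X (τx₁ j) - X (τx j)) ^ 2) fun v => by simp

/-- The determinant of a matrix of coordinates is the evaluation of the determinant polynomial.
[folklore] -/
theorem aeval_det_X' {n : ℕ} (τ : Fin n → Fin n → α) (e : α → ℝ) :
    aeval e (Matrix.det (Matrix.of fun i j => (X (τ i j) : MvPolynomial α ℚ))) =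
      Matrix.det (Matrix.of fun i j => e (τ i j)) := by
  rw [AlgHom.map_det]
  congr 1
  ext i j
  simp

/-- The Jacobian atom `a = b · |det L|`, written without absolute values:
`(0 ≤ det L ∧ a = b det L) ∨ (det L ≤ 0 ∧ a = -(b det L))`. [folklore] -/
theorem definable_jacAtom {n : ℕ} (τL : Fin n → Fin n → α) (κa κb : α) :
    DefQ {g : α → ℝ |
      (0 ≤ (Matrix.of fun i j => g (τL i j)).det ∧
          g κa = g κb * (Matrix.of fun i j => g (τL i j)).det) ∨
        ((Matrix.of fun i j => g (τL i j)).det ≤ 0 ∧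
          g κa = -(g κb * (Matrix.of fun i j => g (τL i j)).det))} := by
  set D : MvPolynomial α ℚ := Matrix.det (Matrix.of fun i j => (X (τL i j) : MvPolynomial α ℚ))
    with hD
  refine definable_setOf_or_params (definable_setOf_and_params ?_ ?_)
    (definable_setOf_and_params ?_ ?_)
  · exact definable_polyLe 0 D fun v => by rw [map_zero, hD, aeval_det_X']
  · exact definable_polyEq (X κa) (X κb * D) fun v => by
      rw [map_mul, aeval_X, aeval_X, hD, aeval_det_X']
  · exact definable_polyLe D 0 fun v => by rw [map_zero, hD, aeval_det_X']
  · exact definable_polyEq (X κa) (-(X κb * D)) fun v => by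
      rw [map_neg, map_mul, aeval_X, aeval_X, hD, aeval_det_X']

end Summit.KontsevichZagierPeriods.DefinableMoves.CovTransferAux

end
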